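import Summits.CriticalPhenomena.Ising3D.Control2DCellCheck2
import Summits.CriticalPhenomena.Ising3D.Control2DEps102Cuts2
import Summits.CriticalPhenomena.Ising3D.Control2DCertificateEps102
import HarnessLib

/-!
# The 2D control: obligation (C) of certificate `eps102` IN THE KERNEL (second-order scheme) — file H
(cell `pub-ising3x`, seat controls-1; kernel runs of `Control2DCellCheck2.checkSpin2`)

HONEST FRAMING: lottery ticket; floor = tightest certified 3D Ising CFT bounds; no exact-solution claim without a proof.

Kernel evaluations (`decide +kernel`; no `native_decide`, no extra axioms) of the second-order (C)
checker at `P = 80` on the data of certificate `eps102`, one per cut list of `Control2DEps102Cuts2.lean`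
(chunks `c2cuts12`, `c2cuts14`, `c2cuts16`, `c2cuts18`, `c2cuts20`, `c2cuts22`; estimated kernel time of this file ≈ 78 s).
-/

namespace Summit.CriticalPhenomena.Ising3D.Control2D.RB0

open Set
open Literature.MathematicalPhysics.QuantumFieldTheory.ConformalBootstrap3D
open Summit.CriticalPhenomena.Ising3D.Control2D

set_option maxHeartbeats 10000000 in
set_option maxRecDepth 200000 in
/-- (C) of `eps102`, spin `12`, cells of `eps102_c2cuts12` (`50` cells, `N = 20`, depth `5`,
left stencil `none`, extra `97/4`). [folklore] -/
theorem eps102_check2_c2cuts12 :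
    checkSpin2 80 20 12 (eps105_vals.map (NI.ofRat 80)) (mkCData 80 5 12 eps105_vals eps102_w eps1005_z eps1005_zb)
      false (0) eps102_c2cuts12 (97/4) = true := by
  decide +kernel

set_option maxHeartbeats 10000000 in
set_option maxRecDepth 200000 in
/-- (C) of `eps102`, spin `14`, cells of `eps102_c2cuts14` (`42` cells, `N = 18`, depth `5`,
left stencil `none`, extra `97/4`). [folklore] -/
theorem eps102_check2_c2cuts14 :
    checkSpin2 80 18 14 (eps105_vals.map (NI.ofRat 80)) (mkCData 80 5 14 eps105_vals eps102_w eps1005_z eps1005_zb)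
      false (0) eps102_c2cuts14 (97/4) = true := by
  decide +kernel

set_option maxHeartbeats 10000000 in
set_option maxRecDepth 200000 in
/-- (C) of `eps102`, spin `16`, cells of `eps102_c2cuts16` (`33` cells, `N = 16`, depth `4`,
left stencil `none`, extra `97/4`). [folklore] -/
theorem eps102_check2_c2cuts16 :
    checkSpin2 80 16 16 (eps105_vals.map (NI.ofRat 80)) (mkCData 80 4 16 eps105_vals eps102_w eps1005_z eps1005_zb)
      false (0) eps102_c2cuts16 (97/4) = true := by
  decide +kernel

set_option maxHeartbeats 10000000 in
set_option maxRecDepth 200000 in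
/-- (C) of `eps102`, spin `18`, cells of `eps102_c2cuts18` (`25` cells, `N = 14`, depth `4`,
left stencil `none`, extra `97/4`). [folklore] -/
theorem eps102_check2_c2cuts18 :
    checkSpin2 80 14 18 (eps105_vals.map (NI.ofRat 80)) (mkCData 80 4 18 eps105_vals eps102_w eps1005_z eps1005_zb)
      false (0) eps102_c2cuts18 (97/4) = true := by
  decide +kernel

set_option maxHeartbeats 10000000 in
set_option maxRecDepth 200000 in
/-- (C) of `eps102`, spin `20`, cells of `eps102_c2cuts20` (`16` cells, `N = 12`, depth `3`,
left stencil `none`, extra `97/4`). [folklore] -/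
theorem eps102_check2_c2cuts20 :
    checkSpin2 80 12 20 (eps105_vals.map (NI.ofRat 80)) (mkCData 80 3 20 eps105_vals eps102_w eps1005_z eps1005_zb)
      false (0) eps102_c2cuts20 (97/4) = true := by
  decide +kernel

set_option maxHeartbeats 10000000 in
set_option maxRecDepth 200000 in
/-- (C) of `eps102`, spin `22`, cells of `eps102_c2cuts22` (`8` cells, `N = 10`, depth `3`,
left stencil `none`, extra `97/4`). [folklore] -/
theorem eps102_check2_c2cuts22 :
    checkSpin2 80 10 22 (eps105_vals.map (NI.ofRat 80)) (mkCData 80 3 22 eps105_vals eps102_w eps1005_z eps1005_zb)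
      false (0) eps102_c2cuts22 (97/4) = true := by
  decide +kernel

end Summit.CriticalPhenomena.Ising3D.Control2D.RB0
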